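import Summits.PneNP.PneNP.Theses.DirichletPigeons
import Literature.NumberTheory.DiophantineApproximation.SimultaneousDirichlet

/-!
# Route DirichletPigeons — the SPLIT of the deciding crux `GsaPriceOfDimension` (stmt-PneNP-10856)

Typed decomposition (planner, crux-strategist / BC2 redirect) of thesis X = `GsaPriceOfDimension` into

* `MinkowskiPriceOfDimension` (crux, stmt-PneNP-17627): MINKOWSKI_∞ has no `2^{δ n}·poly` solver for some `δ > 0`;
* `MinkowskiToDirichlet` (crux C3, stmt-PneNP-10862): MINKOWSKI_∞ ≤ DIRICHLET, fine-grained, exponent-linear;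
* `GsaThresholdSearch` (support, stmt-PneNP-17628): a `2^{δ d}·poly` GSA decider yields a `2^{δ d}·poly`
  machine returning the LEAST YES bound of GSA`(a, b, ·, ε(b,Q))`, `ε(b,Q) = ⌊(b−1)/Q⌋/b`, on every valid
  DIRICHLET instance that has one below `Q^d`;

with the assembly `MinkowskiPriceOfDimension → MinkowskiToDirichlet → GsaThresholdSearch → GsaPriceOfDimension`
PROVED here (`dirichletPigeons_gsaPriceOfDimension_of_minkowski`), through C2 = `DirichletPriceOfDimension`:

1. `dirichletPigeons_dirichletPriceOfDimension_of_minkowski : MinkowskiPriceOfDimension → MinkowskiToDirichlet →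
   DirichletPriceOfDimension` — exponent bookkeeping (`δ₀ = c·δ₁`);
2. `dirichletPigeons_gsaPriceOfDimension_of_dirichlet : DirichletPriceOfDimension → GsaThresholdSearch →
   GsaPriceOfDimension` — the Diophantine seam: if GSA ∈ TIME(2^{δd}·poly) for C2's `δ`, the search machine
   returns on every valid DIRICHLET instance the least YES bound `N ≤ Q^d` at the threshold `ε(b,Q)`; such a
   bound exists by Dirichlet's pigeonhole principle (Hardy–Wright Thm 200, in the route's spelling
   `|q aᵢ/b − round(q aᵢ/b)| < 1/Q`) and the discretisation `‖k/b‖ < 1/Q ↔ ‖k/b‖ ≤ ⌊(b−1)/Q⌋/b` (the distances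
   are multiples of `1/b`); by minimality the least YES bound is its own witness (`q = N`), hence a DIRICHLET
   solution computed within `2^{δd}·poly` — contradicting C2.

All statements are the route's inline (`let`-bound) terms; the proofs `unfold`/`dsimp only` them.
-/

set_option linter.dupNamespace false -- `Summit.PneNP.PneNP.…`: summit = sub-problem name (D-0017 single-conjunct layout)

namespace Summit.PneNP.PneNP.Theorems

open Summit.PneNP.PneNP.Theses.DirichletPigeons
open Literature.NumberTheory.DiophantineApproximation

/-! ### Helper lemmas (Literature vocabulary: `distNearestInt x = |x - round x|`) -/

/-- The Dirichlet threshold as a GSA tolerance: for an integer `k` and `1 ≤ b`, `1 ≤ Q`,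
`‖k/b‖ < 1/Q ↔ ‖k/b‖ ≤ ⌊(b-1)/Q⌋ / b` (the distance is `m/b` for a natural `m`). [folklore] -/
theorem dirichletPigeons_distNearestInt_div_lt_iff_le_threshold (k : ℤ) {b Q : ℕ} (hb : 1 ≤ b) (hQ : 1 ≤ Q) :
    distNearestInt ((k : ℚ) / b) < 1 / (Q : ℚ) ↔
      distNearestInt ((k : ℚ) / b) ≤ ((((b - 1) / Q : ℕ)) : ℚ) / (b : ℚ) := by
  have hb0 : 0 < b := hb
  have hbq : (0 : ℚ) < b := by exact_mod_cast hb0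
  have hQq : (0 : ℚ) < Q := by exact_mod_cast hQ
  obtain ⟨m, hm⟩ := exists_nat_distNearestInt_intCast_div_natCast (K := ℚ) k hb0
  rw [hm]
  constructor
  · intro h
    have h1 : (m : ℚ) * Q < 1 * b := (div_lt_div_iff₀ hbq hQq).1 h
    have h2 : m * Q < b := by exact_mod_cast (by simpa using h1 : (m : ℚ) * Q < b)
    have h3 : m ≤ (b - 1) / Q := (Nat.le_div_iff_mul_le hQ).2 (by omega)
    have h4 : (m : ℚ) ≤ (((b - 1) / Q : ℕ) : ℚ) := by exact_mod_cast h3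
    exact div_le_div_of_nonneg_right h4 hbq.le
  · intro h
    have h1 : (m : ℚ) ≤ (((b - 1) / Q : ℕ) : ℚ) := (div_le_div_iff_of_pos_right hbq).1 h
    have h2 : m ≤ (b - 1) / Q := by exact_mod_cast h1
    have h3 : m * Q ≤ b - 1 := (Nat.le_div_iff_mul_le hQ).1 h2
    have h4 : m * Q < b := by omega
    have h5 : (m : ℚ) * Q < 1 * b := by
      have : ((m * Q : ℕ) : ℚ) < (b : ℚ) := by exact_mod_cast h4
      simpa using this
    exact (div_lt_div_iff₀ hbq hQq).2 h5

/-- The same in the route's spelling: the point `q * a / b` and `|x - round x|` for `‖x‖`. [folklore] -/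
theorem dirichletPigeons_abs_sub_round_lt_iff_le_threshold (q : ℕ) (a : ℤ) {b Q : ℕ} (hb : 1 ≤ b) (hQ : 1 ≤ Q) :
    |(q : ℚ) * a / b - ((round ((q : ℚ) * a / b) : ℤ) : ℚ)| < 1 / (Q : ℚ) ↔
      |(q : ℚ) * a / b - ((round ((q : ℚ) * a / b) : ℤ) : ℚ)| ≤ ((((b - 1) / Q : ℕ)) : ℚ) / (b : ℚ) := by
  have hx : (q : ℚ) * a / b = (((q : ℤ) * a : ℤ) : ℚ) / b := by push_cast; ring
  have h := dirichletPigeons_distNearestInt_div_lt_iff_le_threshold ((q : ℤ) * a) hb hQ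
  rw [distNearestInt_def, ← hx] at h
  exact h

/-- Dirichlet's simultaneous approximation theorem in the route's spelling: some `1 ≤ q ≤ Q^d` has
`|q aᵢ/b - round(q aᵢ/b)| < 1/Q` for all `i` (pigeonhole;
`exists_forall_distNearestInt_natCast_mul_lt`). [cite: HardyWright2008, §11.12 (proof of Theorem 200)] -/
theorem dirichletPigeons_exists_denominator_lt (d : ℕ) (a : Fin d → ℤ) (b : ℕ) {Q : ℕ} (hQ : 1 ≤ Q) :
    ∃ q : ℕ, 1 ≤ q ∧ q ≤ Q ^ d ∧
      ∀ i : Fin d, |(q : ℚ) * a i / b - ((round ((q : ℚ) * a i / b) : ℤ) : ℚ)| < 1 / (Q : ℚ) := by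
  obtain ⟨q, hq1, hqQ, h⟩ :=
    exists_forall_distNearestInt_natCast_mul_lt (K := ℚ) (fun i : Fin d => (a i : ℚ) / b) hQ
  refine ⟨q, hq1, hqQ, fun i => ?_⟩
  have := h i
  rw [distNearestInt_def] at this
  simpa [mul_div_assoc] using this

/-! ### The implications between the route's items -/

/-- **C2 from the Minkowski floor and C3**: `MinkowskiPriceOfDimension → MinkowskiToDirichlet →
DirichletPriceOfDimension`. If MINKOWSKI_∞ has no `2^{δ₀ n}·poly` solver and every `2^{δ d}·poly` DIRICHLET
solver yields a `2^{c δ n}·poly` MINKOWSKI_∞ solver, then DIRICHLET has no `2^{(δ₀/c) d}·poly` solver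
(the pieces share C3's inline predicates verbatim, so this is exponent bookkeeping). [folklore] -/
theorem dirichletPigeons_dirichletPriceOfDimension_of_minkowski :
    MinkowskiPriceOfDimension → MinkowskiToDirichlet → DirichletPriceOfDimension := by
  intro hF hC3
  unfold MinkowskiPriceOfDimension at hF
  unfold MinkowskiToDirichlet at hC3
  unfold DirichletPriceOfDimension
  dsimp only at hF hC3 ⊢
  obtain ⟨δ₀, hδ₀, hnot⟩ := hF
  obtain ⟨c, hc, hred⟩ := hC3
  obtain ⟨δ₁, rfl⟩ : ∃ δ₁ : ℝ, δ₀ = c * δ₁ := ⟨δ₀ / c, by field_simp⟩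
  have hδ₁ : 0 < δ₁ := (mul_pos_iff_of_pos_left hc).1 hδ₀
  refine ⟨δ₁, hδ₁, fun f hf hT => hnot ?_⟩
  exact hred δ₁ hδ₁ ⟨f, hf, hT⟩

/-- **Thesis X from C2 and decision-to-search**: `DirichletPriceOfDimension → GsaThresholdSearch →
GsaPriceOfDimension`. Suppose GSA ∈ TIME(2^{δ d}·poly) for the `δ` of C2. The search machine returns, on every
valid DIRICHLET instance with a YES threshold below `Q^d`, the least `N ≤ Q^d` with GSA`(a, b, N, ε(b,Q))` = YES,
`ε(b,Q) = ⌊(b-1)/Q⌋/b`. By Dirichlet's pigeonhole principle and the discretisation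
`‖q aᵢ/b‖ < 1/Q ↔ ‖q aᵢ/b‖ ≤ ε(b,Q)` such a threshold exists; by minimality the least YES bound is itself a
good denominator, hence a DIRICHLET solution — contradicting C2. [cite: Lagarias1985, §1 (GSA vs. Dirichlet's theorem)] -/
theorem dirichletPigeons_gsaPriceOfDimension_of_dirichlet :
    DirichletPriceOfDimension → GsaThresholdSearch → GsaPriceOfDimension := by
  intro hC2 hS
  unfold DirichletPriceOfDimension at hC2
  unfold GsaThresholdSearch at hS
  unfold GsaPriceOfDimension
  dsimp only at hC2 hS ⊢
  obtain ⟨δ, hδ, hC⟩ := hC2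
  refine ⟨δ, hδ, fun hG => ?_⟩
  obtain ⟨g, hg, hT⟩ := hS δ hδ hG
  refine hC g (fun J hb hQ => ?_) hT
  -- `J = (⟨d, a⟩, b, Q)`; the threshold `ε = ⌊(b-1)/Q⌋ / b`
  have hlead := hg J hb hQ
  -- Dirichlet: a denominator below `Q^d` meets the strict bound, hence the threshold
  obtain ⟨q₀, hq₀1, hq₀Q, hq₀⟩ := dirichletPigeons_exists_denominator_lt J.1.1 J.1.2 J.2.1 hQ
  have hex : ∃ N : ℕ, 1 ≤ N ∧ N ≤ J.2.2 ^ J.1.1 ∧ ∃ q : ℕ, 1 ≤ q ∧ q ≤ N ∧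
      ∀ i : Fin J.1.1, |(q : ℚ) * J.1.2 i / J.2.1 - ((round ((q : ℚ) * J.1.2 i / J.2.1) : ℤ) : ℚ)| ≤
        ((((J.2.1 - 1) / J.2.2 : ℕ)) : ℚ) / (J.2.1 : ℚ) :=
    ⟨q₀, hq₀1, hq₀Q, q₀, hq₀1, le_rfl, fun i =>
      (dirichletPigeons_abs_sub_round_lt_iff_le_threshold q₀ (J.1.2 i) hb hQ).1 (hq₀ i)⟩
  obtain ⟨hg1, hgQ, ⟨q, hq1, hqg, hqε⟩, hmin⟩ := hlead hex
  -- minimality: the witness of the least YES-bound is that bound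
  have hq : q = g J := by
    by_contra hne
    exact hmin q hq1 (lt_of_le_of_ne hqg hne) ⟨q, hq1, le_rfl, hqε⟩
  subst hq
  exact ⟨hg1, hgQ, fun i => (dirichletPigeons_abs_sub_round_lt_iff_le_threshold _ (J.1.2 i) hb hQ).2 (hqε i)⟩

/-- **The split of thesis X (stmt-PneNP-10856)**: `MinkowskiPriceOfDimension → MinkowskiToDirichlet →
GsaThresholdSearch → GsaPriceOfDimension`, the composite of the two previous implications through C2.
This is the glue theorem for `ledger route edit --split GsaPriceOfDimension --into
{MinkowskiPriceOfDimension, MinkowskiToDirichlet, GsaThresholdSearch} --glue-by …`. [folklore] -/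
theorem dirichletPigeons_gsaPriceOfDimension_of_minkowski :
    MinkowskiPriceOfDimension → MinkowskiToDirichlet → GsaThresholdSearch → GsaPriceOfDimension :=
  fun hF hC3 hS =>
    dirichletPigeons_gsaPriceOfDimension_of_dirichlet (dirichletPigeons_dirichletPriceOfDimension_of_minkowski hF hC3) hS

end Summit.PneNP.PneNP.Theorems
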